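import Summits.RiemannHypothesis.RiemannHypothesis.Theses.WeilComb
import Summits.RiemannHypothesis.RiemannHypothesis.Theorems.CombSubcritical.Negative.WeilCombCombSubcriticalLoadBearing
import Literature.NumberTheory.LFunctions.WeilExplicitProofs
import Literature.NumberTheory.LFunctions.WeilExplicitFormulaProofs

/-!
# `WeilComb.CombConverse` (item stmt-RiemannHypothesis-1028): RH ⇒ comb positivity

Calibration item of route `RiemannHypothesis/WeilComb`: the Riemann hypothesis implies that every
log-integer comb `g = x ↦ Σ_{m=1}^{M} a m · ε⁻¹ φ((x − log m)/ε)` built on a Weil test `φ` has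
`0 ≤ Re W(g ⋆ g̃)`.  This is the easy half of Weil's criterion (Weil 1952; Bombieri 2000 §3,
eq. (3.2)), in tree as `WeilPositivity.of_riemannHypothesis` applied with the discharged explicit
formula `explicit_formula_holds`, once the comb is known to be a Weil test
(`weilComb_isWeilTest_comb`: a finite sum of dilated translates of a smooth compactly supported
function is smooth with compact support).  The support hypothesis `tsupport φ ⊆ [-1, 1]` is not
needed.  Shows that the crux `CombShapePositivity` is not stronger than RH.
-/

noncomputable section

namespace Summit.RiemannHypothesis.RiemannHypothesis.Theorems

open Literature.NumberTheory.LFunctions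
open Summit.RiemannHypothesis.RiemannHypothesis.Theses.WeilComb

/-- **`CombConverse` (RH ⇒ comb positivity).** If the Riemann hypothesis holds then for every Weil
test `φ` (with `tsupport φ ⊆ [-1,1]`, unused), every `ε > 0`, `M : ℕ` and `a : ℕ → ℂ`, the comb
`x ↦ Σ_{m ∈ [1, M]} a m · ε⁻¹ φ((x − log m)/ε)` satisfies `0 ≤ Re (weilQuadratic comb)`.
Proof: the comb is a Weil test (`weilComb_isWeilTest_comb`), and RH gives Weil positivity of every
Weil test (`WeilPositivity.of_riemannHypothesis explicit_formula_holds`). [cite: Bombieri2000, §3 Thm 1 eq. (3.2)] -/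
theorem combConverse_proof : CombConverse := by
  unfold CombConverse
  intro hRH φ hφ _hsupp ε hε M a
  exact WeilPositivity.of_riemannHypothesis explicit_formula_holds hRH _
    (weilComb_isWeilTest_comb hφ hε.ne' M a)

end Summit.RiemannHypothesis.RiemannHypothesis.Theorems

end
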